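import Summits.HodgeConjecture.HodgeConjecture.Theses.NikulinTwinTransport

/-!
# Negative knowledge for crux `NikulinSerreCarrier` (stmt-HodgeConjecture-14464): wall chamber, ribbons, geodesy

Sorry-free cores of generation 4 of the disproof work-file `Cruxes/NikulinSerreCarrier/Disproof.lean`
(refuter-cdisprove-stmt-HodgeConjecture-14464-g4-0, §M–§N):

* `no_separating_wall` — walls of type `(2, 0, n_X)` between the frame class `ω = λL_h − Σε_kr_k` and the
  `ι`-invariant polarisation `L_h` need `n_X ≥ (λL_h²)²/(4|ε|²) − L_h²`; below that, `L_h` is in the closure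
  of the chamber of `ω`, `θ(L_h)` is nef on the slice moduli space and the Uhlenbeck datum of the slices is
  constant along every nodal curve (case γ of the rigidity theorem is then impossible);
* `ribbon_degree`, `single_ribbon_forces_d_eq_one`, `nX_single_ribbon` — the degree shells of the ribbon
  lemma (`e = 2d`) and of the isotropic-fibre test (`d_j = 1` for a single moving ribbon);
* `second_fundamental_form_vanishes` — trianalytic ⇒ totally geodesic (pointwise, module-theoretic);
* the Grothendieck–Riemann–Roch package of a carrier and the rank-2 integrality census
  (`chiEnd_eq_gammaY_sub`, `leray_consistency`, `gammaY_rank_two_gt`, `census_m_two`,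
  `census_m_two_nX_six`, `census_nX_six_dead`, `single_ribbon_congruence`);
* `transfer_core` — the linear algebra behind the line stub `stub_mixedClassTransfer` (v3): the address
  equation `T′ ∘ Ψ = −2m` gives the carrier equation `T = −m·Ψ` with the same `m`.

See the work-file docblock for the geometric statements these certify; nothing here asserts a Theses
declaration.
-/

set_option linter.dupNamespace false

namespace Summit.HodgeConjecture.HodgeConjecture.Theorems.NikulinSerreCarrier.Negative.WallChamberRibbon

open Finset

/-! ## Wall chamber, Uhlenbeck constancy, ribbons (Disproof §M) -/

section WallChamber

/-- **No separating wall (★★).**  Walls of `(r, c₁, c₂) = (2, 0, n_X)` between `ω = λL_h − Σε_kr_k`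
and `L_h` are `η^⊥`, `η = aL_h + e` (`a ≥ 1`, `e ∈ E₈(−2)`, `η² = a²L_h² + e² ≥ −n_X`), with
`η·L_h = aL_h² > 0` but `η·ω = aλL_h² − S ≤ 0`, `S := (Σε_kr_k)·e`.  Cauchy–Schwarz in the negative
definite `E₈(−2)` gives `S² ≤ 4|ε|²·|e²|`, and `|e²| ≤ n_X + a²L_h²`.  If `4|ε|²(n_X + L_h²) < λ²(L_h²)²`
then `S < aλL_h²` for every `a ≥ 1`: no wall separates, `L_h` lies in the closure of the chamber of `ω`,
`θ(L_h)` is nef on `M_ω(2,0,s)` and every `ω`-stable sheaf is `μ_{L_h}`-semistable. -/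
theorem no_separating_wall (a L2 lam eps2 nX e2 S : ℝ) (ha : 1 ≤ a) (hL : 0 < L2)
    (hn : 0 ≤ nX) (hwall : -nX ≤ a ^ 2 * L2 + e2)
    (hCS : S ^ 2 ≤ 4 * eps2 * (-e2)) (heps : 0 ≤ eps2)
    (hsmall : 4 * eps2 * (nX + L2) < lam ^ 2 * L2 ^ 2) (hlam : 0 < lam) :
    S < a * lam * L2 := by
  have h1 : -e2 ≤ nX + a ^ 2 * L2 := by linarith
  have ha2 : 1 ≤ a ^ 2 := by nlinarith
  have h2 : nX + a ^ 2 * L2 ≤ a ^ 2 * (nX + L2) := by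
    nlinarith [mul_nonneg (sub_nonneg.2 ha2) hn]
  have h3 : S ^ 2 < (a * lam * L2) ^ 2 := by
    calc S ^ 2 ≤ 4 * eps2 * (-e2) := hCS
      _ ≤ 4 * eps2 * (a ^ 2 * (nX + L2)) := by nlinarith
      _ = a ^ 2 * (4 * eps2 * (nX + L2)) := by ring
      _ < a ^ 2 * (lam ^ 2 * L2 ^ 2) := by
          apply mul_lt_mul_of_pos_left hsmall; positivity
      _ = (a * lam * L2) ^ 2 := by ring
  have hpos : 0 < a * lam * L2 := by positivity
  nlinarith [sq_nonneg (S - a * lam * L2), sq_nonneg (S + a * lam * L2), abs_nonneg S]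

/-- **Ribbon lemma (case β, `w = 2`).**  `W ⊂ X × N_j` is the zero scheme of a section of the rank-2
bundle `V′ = G|_{X×N_j} ⊗ (𝒪(c_jr_j) ⊠ 𝒪(−d))`, l.c.i. of codimension 2; in case β with `w = 2` it is a
double structure (ribbon) on `C = {x₀} × ℙ¹` with `I_C/I_W ≅ 𝒪(e)`, `e` = degree of the rotation map
`N_j → ℙ(T_{x₀}X)`.  Then `χ(𝒪_W) = χ(𝒪_C) + χ(𝒪(e)) = e + 2`, `deg ω_W = −2χ(𝒪_W)`,
`deg_W(𝓜) = 2·deg(𝓜|_C)` for every line bundle, while the Serre correspondence gives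
`ω_W ≅ (ω_{X×ℙ¹} ⊗ det V′)|_W` of `C`-degree `−2d − 2`.  Hence `e = 2d`: the rotation is a cover of
degree exactly `2d ≥ 2` (the `e = 1` "isomorphic" escape recorded in §K is closed). -/
theorem ribbon_degree (e d chiW degW degC : ℤ) (hchi : chiW = e + 2) (hdual : degW = -2 * chiW)
    (hmult : degW = 2 * degC) (hserre : degC = -2 * d - 2) : e = 2 * d := by omega

/-- **Isotropic-fibre test (case β, single moving ribbon) forces `d_j = 1`.**  Along `R_j = f(N_j)` the
`X`-slices lie in the Uhlenbeck fibre `P = ℙ(𝓔) → ℙ¹_u`, `𝓔 = 𝓔xt¹_π(B⊗𝓘_𝒲, A) ≅ 𝒪^{N} ⊕ 𝒪(−1)`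
(`N = 8c² − 1 + s`, from `0 → H¹(A−B)⊗𝒪 → 𝓔 → 𝓔xt²_π(B⊗𝒪_𝒲, A) ≅ (π_*𝒪_𝒲)^∨ ≅ 𝒪 ⊕ 𝒪(−1) → 0`),
which is ISOTROPIC (fibre of the birational symplectic contraction `M → M^{μss}_{L_h}`, Kaledin).  With
`u = π ∘ φ` of degree `2d` (ribbon lemma) and `φ^*𝒪_P(1)` of degree `2d` (`θ(r_j)|_P = (B·r_j)H = −4cH`,
`θ(r_j)·R_j = −4m = −8cd`), the relative Euler sequence pulls back to
`0 → 𝒪 → 𝒪(2d)^N ⊕ 𝒪 → φ^*T_{P/ℙ¹} → 0` where the tautological line projects ISOMORPHICALLY onto the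
`𝒪`-summand (local freeness of `G_p` at `x₀` = the extension class generates the socle of `ω_{W_p}`), so
`φ^*T_{P/ℙ¹} ≅ 𝒪(2d)^N` and `φ^*TP ∈ Ext(𝒪(4d), 𝒪(2d)^N)`.  §K Step 2 (σ-nondegeneracy of `Z` along
`R_j`) needs a retraction `φ^*TP → TN_j = 𝒪(2)`, nonzero on `𝒪(2d)^N` since `Hom(𝒪(4d), 𝒪(2)) = 0`;
`Hom(𝒪(2d), 𝒪(2)) ≠ 0` forces `2d ≤ 2`.  Degree shell: -/
theorem single_ribbon_forces_d_eq_one (d : ℤ) (hd : 1 ≤ d) (hret : 2 * d ≤ 2 ∨ 4 * d ≤ 2) :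
    d = 1 := by omega

/-- … and then `c_j = m/(2d_j) = m/2`, so `n_X = 4c_j² + w_j = m² + 2 + s_j` (`s_j` = number of static
reduced lines accompanying the ribbon). -/
theorem nX_single_ribbon (m c nX w s : ℤ) (hc : 2 * c = m) (hn : nX = 4 * c ^ 2 + w)
    (hw : w = 2 + s) : nX = m ^ 2 + 2 + s := by
  subst hc; subst hw; rw [hn]; ring

end WallChamber

/-! ## Totally geodesic twin (Disproof §M′) -/

section Geodesy

variable {V N : Type*} [AddCommGroup V] [AddCommGroup N] [Module ℚ N]

/-- **Trianalytic ⇒ totally geodesic (pointwise core).**  `h` = second fundamental form of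
`Z = f(Y′) ⊂ M` (symmetric, `ℤ`-bilinear, values in the normal space), complex-linear in the first slot
for TWO anticommuting complex structures `I, J` of the hyperkähler triple (`h(Iv,w) = I′h(v,w)`,
`h(Jv,w) = J′h(v,w)` with `I′² = J′² = −1`, `I′J′ = −J′I′` on the normal space): then `h = 0`.  So the twin
`Z` is totally geodesic in `(M, g_{L²})`, `TM|_Z = TZ ⊕ N_Z` is a PARALLEL splitting, `N_Z` is
hyperholomorphic (polystable, `c₁ = 0`, holomorphic symplectic), and `c₂(f^*TM) = 24 + c₂(N_Z)`. -/
theorem second_fundamental_form_vanishes (h : V →+ V →+ N) (hsymm : ∀ v w, h v w = h w v)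
    (I J : V → V) (I' J' : N →ₗ[ℚ] N) (hI' : ∀ n, I' (I' n) = -n) (hJ' : ∀ n, J' (J' n) = -n)
    (hanti : ∀ n, I' (J' n) = -J' (I' n))
    (hI : ∀ v w, h (I v) w = I' (h v w)) (hJ : ∀ v w, h (J v) w = J' (h v w)) (v w : V) :
    h v w = 0 := by
  -- a complex structure `T` with `h(Tv,w) = T′h(v,w)`, `T′² = −1` gives `h(Tv,Tw) = −h(v,w)`
  have key : ∀ (T : V → V) (T' : N →ₗ[ℚ] N), (∀ n, T' (T' n) = -n) →
      (∀ v w, h (T v) w = T' (h v w)) → ∀ v w, h (T v) (T w) = -h v w := by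
    intro T T' hT' hT v w
    rw [hT, hsymm v (T w), hT, hT', hsymm]
  have hII := key I I' hI' hI
  have hJJ := key J J' hJ' hJ
  -- `K = I ∘ J`, `K′ = I′ ∘ J′` is again such a pair
  have hK : ∀ v w, h (I (J v)) w = (I' ∘ₗ J') (h v w) := by
    intro v w; rw [hI, hJ]; rfl
  have hK' : ∀ n, (I' ∘ₗ J') ((I' ∘ₗ J') n) = -n := by
    intro n
    simp only [LinearMap.coe_comp, Function.comp_apply]
    have h1 : J' (I' (J' n)) = -I' (J' (J' n)) := by
      have := hanti (J' n); rw [this]; simp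
    rw [h1, hJ']
    simp [map_neg, hI']
  have hKK := key (fun v => I (J v)) (I' ∘ₗ J') hK' hK v w
  -- but also h(IJv, IJw) = -h(Jv,Jw) = h(v,w)
  have hKK' : h (I (J v)) (I (J w)) = h v w := by rw [hII, hJJ, neg_neg]
  have h2 : (2 : ℚ) • h v w = 0 := by
    rw [two_smul]
    nth_rewrite 1 [← hKK']
    rw [hKK, neg_add_cancel]
  exact (smul_eq_zero.mp h2).resolve_left two_ne_zero

end Geodesy

/-! ## The Grothendieck–Riemann–Roch package of a carrier (Disproof §M″) -/

section GRR

/-- **Consistency of the GRR package.**  With `Γ_Y := c₂(f^*TM) = 44m² + 2n_Xn_Y +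
(r/6)(44m² + 2n_Xn_Y − 2c₄) − 4rn_Y` (GRR for `R¹π_*𝓔nd G`) and `χ(𝓔nd G) = 4r² − 4r(n_X+n_Y) + 44m² +
2n_Xn_Y + (r/3)(22m² + n_Xn_Y − c₄)` (HRR on `X × Y′`): `χ(𝓔nd G) = Γ_Y − 2v²`, `v² = 2r(n_X − r)`. -/
theorem chiEnd_eq_gammaY_sub (r nX nY m c4 : ℚ) :
    4 * r ^ 2 - 4 * r * (nX + nY) + 44 * m ^ 2 + 2 * nX * nY + r / 3 * (22 * m ^ 2 + nX * nY - c4) =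
      (44 * m ^ 2 + 2 * nX * nY + r / 6 * (44 * m ^ 2 + 2 * nX * nY - 2 * c4) - 4 * r * nY) -
        2 * (2 * r * (nX - r)) := by
  ring

/-- Leray for `π : X × Y′ → Y′` (`R⁰ = R² = 𝒪`, `R¹ = f^*TM = TY′ ⊕ N`): `χ(𝓔nd G) = 24 − χ(N)`, and
`χ(N) = 2·rk N − c₂(N)`, `rk N = v²`, `Γ_Y = 24 + c₂(N)` reproduce `χ(𝓔nd G) = Γ_Y − 2v²`. -/
theorem leray_consistency (Γ c2N v2 chiN chiE : ℚ) (hΓ : Γ = 24 + c2N) (hχN : chiN = 2 * v2 - c2N)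
    (hE : chiE = Γ - 2 * v2) : chiE = 24 - chiN := by
  subst hΓ; subst hχN; subst hE; ring

/-- **Rank 2** (`c₃ = c₄ = 0`): `Γ_Y = (176m² + 8n_Xn_Y)/3 − 8n_Y`, so
`c₂(N_Z) = (176m² + 8n_Xn_Y)/3 − 8n_Y − 24`; for admissible data (`n_X ≥ 4`, `m ≥ 2`) `Γ_Y > 234`, so the
positivity `c₂(N_Z) ≥ 0` of the polystable degree-0 normal bundle never bites. -/
theorem gammaY_rank_two_gt (nX nY m : ℚ) (hX : 4 ≤ nX) (hY : 0 ≤ nY) (hm : 2 ≤ m) :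
    234 < (44 * m ^ 2 + 2 * nX * nY + 2 / 6 * (44 * m ^ 2 + 2 * nX * nY - 2 * 0) - 4 * 2 * nY) := by
  have h1 : (8 / 3 : ℚ) * nY ≤ 8 * nX * nY / 3 - 8 * nY := by nlinarith
  nlinarith

/-- **Integrality census, `m = 2`**: `χ(G) ∈ ℤ` is `6 ∣ 22m² + n_Xn_Y` (rank 2), i.e.
`n_Xn_Y ≡ 2 (mod 6)` for `m = 2`. -/
theorem census_m_two (p : ℤ) (h : (6 : ℤ) ∣ 22 * 2 ^ 2 + p) : p % 6 = 2 := by omega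

/-- … so `(m, n_X) = (2, 6)` — the minimal case-β charge `n_X = 4c² + 2`, `c = 1` — is impossible. -/
theorem census_m_two_nX_six (nY : ℤ) : ¬ (6 : ℤ) ∣ 22 * 2 ^ 2 + 6 * nY := by omega

/-- **Single moving ribbon with no static lines** (`n_X = m² + 2`): `6 ∣ 22m² + (m² + 2)n_Y` forces
`3 ∣ m` (so `6 ∣ m`) and `3 ∣ n_Y`; the smallest such datum is `m = 6`, `n_X = 38`. -/
theorem single_ribbon_congruence (m nY : ℤ) (h : (6 : ℤ) ∣ 22 * m ^ 2 + (m ^ 2 + 2) * nY) :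
    (3 : ℤ) ∣ m ∧ (3 : ℤ) ∣ nY := by
  have h3 : (3 : ℤ) ∣ 22 * m ^ 2 + (m ^ 2 + 2) * nY := dvd_trans ⟨2, by norm_num⟩ h
  have hz : ((22 * m ^ 2 + (m ^ 2 + 2) * nY : ℤ) : ZMod 3) = 0 :=
    (ZMod.intCast_zmod_eq_zero_iff_dvd _ 3).2 h3
  push_cast at hz
  have key : ∀ a b : ZMod 3, 22 * a ^ 2 + (a ^ 2 + 2) * b = 0 → a = 0 ∧ b = 0 := by decide
  obtain ⟨ha, hb⟩ := key _ _ hz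
  exact ⟨(ZMod.intCast_zmod_eq_zero_iff_dvd m 3).1 ha, (ZMod.intCast_zmod_eq_zero_iff_dvd nY 3).1 hb⟩


/-- **`n_X = 6` is dead for every `m`** (rank 2, locally free, small-charge regime).  `n_X = 4c_j² + w_j` with
`c_j ≥ 1`, `w_j ≥ 2` forces `c_j = 1`, `w_j = 2`: a single moving ribbon, so `d_j = 1` (isotropic-fibre test),
`m = 2c_jd_j = 2`, and then `6 ∣ 22m² + 6n_Y` fails. -/
theorem census_nX_six_dead (m nY c w d : ℤ) (hc : 1 ≤ c) (hw : 2 ≤ w) (hn : (6 : ℤ) = 4 * c ^ 2 + w)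
    (hribbon : w = 2 → d = 1) (hm : m = 2 * c * d) (hint : (6 : ℤ) ∣ 22 * m ^ 2 + 6 * nY) : False := by
  have hc1 : c = 1 := by nlinarith
  subst hc1
  have hw2 : w = 2 := by omega
  have hd := hribbon hw2
  subst hd
  have hm2 : m = 2 := by omega
  subst hm2
  omega

end GRR

/-! ## The transfer stub is linear algebra (Disproof §N) -/

section Transfer

variable {K X Y : Type*} [CommRing K] [AddCommGroup X] [Module K X] [AddCommGroup Y] [Module K Y]

/-- **Transfer core (support lemma for `stub_mixedClassTransfer`, v3).**  `B_X`, `B_Y` the cup pairings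
on `H²(X)`, `H²(Y′)` (`B_X` separating), `Ψ : H²(Y′) → H²(X)` surjective with
`B_X(Ψy, Ψy′) = 2B_Y(y, y′)`, and `T : H²(Y′) → H²(X)`, `T′ : H²(X) → H²(Y′)` mutually adjoint
(`T y = Σ_i B_Y(y, g^*b_i)a_i`, `T′x = Σ_i B_X(x, a_i)g^*b_i` for `κ^{2,2} = Σ a_i ⊗ b_i`: projection
formula + Künneth).  If the address equation `T′ ∘ Ψ = −2m` holds then the carrier equation `T = −m·Ψ`
holds with the SAME `m` — the stub's `∃ m′ ≠ 0` is witnessed by `m′ = m`, over any coefficient ring. -/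
theorem transfer_core (BX : X →ₗ[K] X →ₗ[K] K) (BY : Y →ₗ[K] Y →ₗ[K] K)
    (hsep : ∀ x : X, (∀ z, BX x z = 0) → x = 0) (Ψ T : Y →ₗ[K] X) (T' : X →ₗ[K] Y)
    (hΨ : Function.Surjective Ψ) (hsim : ∀ y y', BX (Ψ y) (Ψ y') = 2 * BY y y')
    (hadj : ∀ y x, BX (T y) x = BY y (T' x)) (m : K) (haddr : ∀ y, T' (Ψ y) = (-(2 * m)) • y)
    (y : Y) : T y = (-m) • Ψ y := by
  have h0 : T y + m • Ψ y = 0 := by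
    refine hsep _ fun z => ?_
    obtain ⟨y', rfl⟩ := hΨ z
    simp only [map_add, map_smul, LinearMap.add_apply, LinearMap.smul_apply, smul_eq_mul, hadj,
      haddr, hsim]
    ring
  rw [neg_smul]
  exact eq_neg_iff_add_eq_zero.mpr h0

end Transfer

end Summit.HodgeConjecture.HodgeConjecture.Theorems.NikulinSerreCarrier.Negative.WallChamberRibbon
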